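import Literature.Barriers.CriticalPhenomena.RigorousRGSmallParameterPerturbativeCoefficients
import HarnessLib

/-!
# `RigorousRGSmallParameter` (Slade, Theorem 1.4.1): Lemma 5.2.1 for `ξ_j` and `ξ^W_j` — the
# Wick-ordered cubic coefficient of the second-order flow, by discrete Taylor expansion and symmetry

Companion of `RigorousRGSmallParameterPerturbativeCoefficients.lean` (the coefficients
`η_j, η_{≥j}, w̄_j^{(1)}, β_j, β^:_j` of §5.1–§5.2 for the explicit decomposition `C_j = FRD.fracCov`
of `ℤ^d`, and their bounds (5.22)). Source: G. Slade, *Critical exponents for long-range `O(n)`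
models below the upper critical dimension*, Commun. Math. Phys. **358** (2018) 343–436,
arXiv:1611.06169, §5.1 (display (5.5): `ξ'_j`), §5.2 ((5.18): `ξ_j = L^{(α-2ε)j}ξ'_j`; the display
after `β^:_j`: `ξ^W_j`), Lemma 5.2.1, and §10.2 "Bound on `ξ_j`" (displays (10.29)–(10.37)). The
formula for `ξ'` is that of R. Bauerschmidt, D. Brydges, G. Slade, *Scaling limits and critical
behaviour of the 4-dimensional `n`-component `|φ|⁴` spin model*, J. Stat. Phys. **157** (2014)
692–742, arXiv:1403.7424, §3 ("`ξ' = 2(2+n)(δ[w^{(3)}] - 3w^{(2)}C_{0,0}) + γβη'`",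
`γ = (n+2)/(n+8)`), from which Slade's Proposition 5.1.1 is taken (`z = y = 0`).

## The printed proof (§10.2, "Bound on `ξ_j`")

"The third term in the formula for `ξ'` in (5.5) is a multiple of `β'_jη'_j = L^{-(α-2ε)j}β_jη_j ≲
M_j²L^{-(α-2ε)j}`. The remaining terms in (5.5) are proportional to (10.30)
`(w_{j+1}^{(3)} - w_j^{(3)}) - 3w_j^{(2)}C_{j+1;0,0} = 3((w_j²C_{j+1})^{(1)} - w_j^{(2)}C_{j+1;0,0}) +
3(w_jC_{j+1}²)^{(1)} + C_{j+1}^{(3)}`. We use `ε = 2α - d` to obtain (10.31) `|C_{j+1}^{(3)}| ≤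
Σ_x|C_{j+1;0,x}³| ≲ M_j³L^{dj}L^{-3(d-α)j} ≲ M_j³L^{-(α-2ε)j}`. Similarly, (10.32) `|(w_jC_{j+1}²)^{(1)}| ≲
M_j²L^{-2(d-α)j}Σ_{k=1}^jL^{dk}L^{-(d-α)k} ≲ M_j²L^{-(α-2ε)j}`. Finally, we write `w_{j,x}² =
Σ_{k=0}^{j-1}δ_k[w_x²]` with `δ_k[w_x²] = w_{k+1,x}² - w_{k,x}²`, so that (10.33) `(w_j²(C_{j+1} -
C_{j+1;0,0}))^{(1)} = Σ_{k=0}^{j-1}Σ_xδ_k[w_x²](C_{j+1;0,x} - C_{j+1;0,0})`. The identity (which follows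
from `w_{-x}² = w_x²`) (10.34) `Σ_xΣ_{i=1}^dδ_k[w_x²]x_i(∇^{e_i}C)_0 = -Σ_xδ_k[w_x²]x_i(∇^{e_i}C)_0 = 0`, and
the bounds (10.35) `|C_{j+1;0,x} - C_{j+1;0,0} - Σ_{i=1}^dx_i(∇^{e_i}C)_0| ≲ |x|²‖∇²C_{j+1}‖_∞ ≲
|x|²M_jL^{-(d-α)j}L^{-2j}`, (10.36) `Σ_xδ_k[w_x²]|x|² ≲ L^{2k}Σ_xδ_k[w_x²] ≲ L^{2k}β'_k ≲ L^{2k}L^{εk}`, then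
imply that (10.37) `|(w_j²(C_{j+1} - C_{j+1;0,0}))^{(1)}| ≲ M_jL^{-(d-α)j}L^{-2j}Σ_{k=0}^{j-1}L^{(2+ε)k} ≲
M_jL^{-(α-2ε)j}`. This gives the desired bound on `ξ_j`. *Bound on `ξ^W`.* This follows from the
definition … together with the estimates obtained above for `ξ_j, η_{≥j}, β_j`."

## What this file does (everything is proved; no named fact is introduced)

* `fracCov_neg`, `wCov_neg` — evenness of `C_j` and `w_j`.
* Discrete calculus on `ℤ^d`: `l1N` (`|x|₁ ∈ ℕ`), `IsUnitStep` (`±e_i`), `exists_unitStep_of_l1N_pos`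
  (peeling one step toward the origin), `abs_sub_le_l1N_mul` (telescoping along a lattice path:
  `|g(b) - g(a)| ≤ |b-a|₁ sup|∇g|`), `abs_symmDiff_le` (`|f(x) + f(-x) - 2f(0)| ≤ |x|₁² sup|∇²f|`),
  `sum_even_mul_sub_eq` (against an even weight, `Σω(f - f(0)) = ½Σω(f(x) + f(-x) - 2f(0))`: the
  linear Taylor term drops out). This is how (10.34)–(10.35) are organised here: symmetrise
  first, then bound the symmetric second difference, instead of expanding to second order and
  cancelling the linear term — the same two ingredients (symmetry of `w²`, second differences
  of `C`), with no need for the mixed Taylor remainder.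
* `abs_latGrad_fracCov_le_massFactor` — (3.9) with gradients in the form
  `|∇^lC_{j;0,x}(m²)| ≤ c(L^{j-1})^{α-d-|l|}M_j` for ALL `m² ∈ [0,m̄²]` (unit-step lists `l`); the value
  at `m² = 0` is obtained from the printed form (`m² > 0`) by continuity in `m²`.
* Definitions `gammaHat` (`γ̂`), `xiPrime` (`ξ'_j`, (5.5)), `xiCoeff` (`ξ_j`, (5.18)), `xiWCoeff`
  (`ξ^W_j`, through the abstract `xiW` of `…ChangeOfVariables.lean`); `delta_w3_decomposition`
  ((10.30)); `sum_wCov_sq_mul_l1N_sq_le` (`Σ_xw_{j;0,x}²|x|₁² ≤ cL^{d+α+2}(L^{2+ε})^j`, the telescoped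
  (10.36) summed over `k`).
* **Lemma 5.2.1 for `ξ`:** `abs_xiCoeff_le` (`|ξ_j| ≤ c_LM_j`), `abs_xiWCoeff_le` (`|ξ^W_j| ≤ c_LM_j`),
  packaged as `Slade2017_lem521_xi`; `continuous_xiCoeff_mass` (`ξ'_j, ξ_j` continuous on `ℝ`),
  `continuousOn_xiWCoeff_mass` (`ξ^W_j` continuous on `[0,L^{-α(j-1)})`, below the mass scale, where
  `β_j` is).

Scope / reading. (i) The constant for `ξ_j` here depends on `L` (through explicit powers); the
printed claim that this particular constant is independent of `L` is not reproduced. (ii) The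
hypotheses are `d ≥ 1`, `0 < α < 2 ∧ d` and `d ≤ 2α` (i.e. `ε ≥ 0`, used in `(L^ε)^{k∧j_m} ≤ (L^ε)^k`);
the printed `d ≤ 3` is not needed. (iii) Not treated: the vacuum-energy coefficients `υ_{*,j}`
and the mass derivative (5.23) of Lemma 5.2.1; Lemmas 5.2.2–5.2.4.

Ledger effect: none on the trust base of the barrier's reduction chain (`Slade2017_prop822`
remains the named fact); with the companion file, the bound `Π = sup_j|ξ^W_j| < ∞` and `B_β` of the
hypotheses `CriticalFlow.Hyp` of Theorem 7.2.2 are now available for the explicit decomposition.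
-/

noncomputable section

namespace Literature.Barriers.CriticalPhenomena

open _root_.MeasureTheory Set Filter
open scoped _root_.Topology Real

namespace LongRangePhi4

namespace PT

open Literature.Probability.LatticeModels FRD

variable {d : ℕ}

/-! ### Evenness of the covariances -/

/-- `C_{j;0,-x} = C_{j;0,x}` (the kernels `Γ_j` are even). [cite: Slade2017, Proposition 3.3.1 (C_{j;x,y} = C_{j;y,x})] -/
theorem fracCov_neg (d : ℕ) (L α m2 : ℝ) (j : ℕ) (x : Site d) :
    fracCov d L α m2 j (-x) = fracCov d L α m2 j x := by
  unfold fracCov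
  simp_rw [Gam_neg]

/-- `w_{j;0,-x} = w_{j;0,x}` ("which follows from `w_{-x}² = w_x²`", (10.34)). [cite: Slade2017, §10.2 (display (10.34))] -/
theorem wCov_neg (d : ℕ) (L α m2 : ℝ) (j : ℕ) (x : Site d) :
    wCov d L α m2 j (-x) = wCov d L α m2 j x := by
  unfold wCov
  simp_rw [fracCov_neg]

/-! ### Discrete calculus on `ℤ^d`: unit steps, paths, second differences -/

/-- The `ℓ¹` norm `|x|₁ = Σ_i |x_i|` of a site, as a natural number. [folklore] -/
def l1N (x : Site d) : ℕ := ∑ i, (x i).natAbs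

/-- `l1N` is the `ℓ¹` norm used (as a real number) in the finite-range statements. [folklore] -/
theorem l1N_cast (x : Site d) : ((l1N x : ℕ) : ℝ) = (((∑ i, (x i).natAbs : ℕ) : ℝ)) := rfl

/-- `|x|₁ = 0 ⟹ x = 0`. [folklore] -/
theorem eq_zero_of_l1N_eq_zero {x : Site d} (h : l1N x = 0) : x = 0 := by
  funext i
  have := (Finset.sum_eq_zero_iff.mp h) i (Finset.mem_univ i)
  exact Int.natAbs_eq_zero.mp this

/-- `|a + b|₁ ≤ |a|₁ + |b|₁`. [folklore] -/
theorem l1N_add_le (a b : Site d) : l1N (a + b) ≤ l1N a + l1N b := by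
  unfold l1N
  rw [← Finset.sum_add_distrib]
  exact Finset.sum_le_sum fun i _ => Int.natAbs_add_le _ _

/-- `|-a|₁ = |a|₁`. [folklore] -/
theorem l1N_neg (a : Site d) : l1N (-a) = l1N a := by
  unfold l1N
  exact Finset.sum_congr rfl fun i _ => Int.natAbs_neg _

/-- Unit steps `±e_i` of `ℤ^d`. [folklore] -/
def IsUnitStep (e : Site d) : Prop := ∃ i : Fin d, e = Pi.single i 1 ∨ e = Pi.single i (-1)

/-- A unit step has `|e|₁ = 1`. [folklore] -/
theorem IsUnitStep.l1N_eq {e : Site d} (he : IsUnitStep e) : l1N e = 1 := by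
  obtain ⟨i, h⟩ := he
  have key : ∀ σ : ℤ, (σ = 1 ∨ σ = -1) → l1N (Pi.single i σ : Site d) = 1 := by
    intro σ hσ
    unfold l1N
    rw [Fintype.sum_eq_single i fun j hj => by rw [Pi.single_eq_of_ne hj, Int.natAbs_zero]]
    rw [Pi.single_eq_same]
    rcases hσ with h | h <;> simp [h]
  rcases h with h | h
  · rw [h]; exact key 1 (Or.inl rfl)
  · rw [h]; exact key (-1) (Or.inr rfl)

/-- A unit step satisfies the hypothesis `Σ_i |e_i| ≤ 1` of the gradient bounds of
Proposition 3.3.1. [folklore] -/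
theorem IsUnitStep.sum_abs_le {e : Site d} (he : IsUnitStep e) : (∑ i, |((e i : ℤ) : ℝ)|) ≤ 1 := by
  have h1 : (∑ i, |((e i : ℤ) : ℝ)|) = ((l1N e : ℕ) : ℝ) := by
    unfold l1N
    push_cast
    refine Finset.sum_congr rfl fun i _ => ?_
    rw [← Int.cast_natCast, Int.natCast_natAbs, Int.cast_abs]
  rw [h1, he.l1N_eq]
  norm_num

/-- **One step toward the origin:** a site `x ≠ 0` is `y + e` for a unit step `e` with
`|y|₁ + 1 = |x|₁`. [folklore] -/
theorem exists_unitStep_of_l1N_pos {x : Site d} (hx : 0 < l1N x) :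
    ∃ e y : Site d, IsUnitStep e ∧ x = y + e ∧ l1N y + 1 = l1N x := by
  classical
  obtain ⟨i, -, hi⟩ : ∃ i ∈ (Finset.univ : Finset (Fin d)), (x i).natAbs ≠ 0 :=
    Finset.exists_ne_zero_of_sum_ne_zero (by unfold l1N at hx; omega)
  have hxi : x i ≠ 0 := fun h => hi (by rw [h, Int.natAbs_zero])
  set σ : ℤ := Int.sign (x i) with hσ
  have hσ1 : σ = 1 ∨ σ = -1 := by
    rcases lt_or_gt_of_ne hxi with h | h
    · exact Or.inr (Int.sign_eq_neg_one_of_neg h)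
    · exact Or.inl (Int.sign_eq_one_of_pos h)
  refine ⟨Pi.single i σ, x - Pi.single i σ, ⟨i, ?_⟩, (sub_add_cancel _ _).symm, ?_⟩
  · rcases hσ1 with h | h
    · exact Or.inl (by rw [h])
    · exact Or.inr (by rw [h])
  · -- the `i`-th coordinate loses one unit of absolute value, the others are unchanged
    have hdiff : ∀ j, |x j| = |(x - Pi.single i σ : Site d) j| + if j = i then 1 else 0 := by
      intro j
      by_cases hj : j = i
      · subst hj
        rw [if_pos rfl, Pi.sub_apply, Pi.single_eq_same]
        rcases lt_or_gt_of_ne hxi with h | h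
        · rw [hσ, Int.sign_eq_neg_one_of_neg h, abs_of_neg h, sub_neg_eq_add,
            abs_of_nonpos (by omega)]
          ring
        · rw [hσ, Int.sign_eq_one_of_pos h, abs_of_pos h, abs_of_nonneg (by omega)]
          ring
      · rw [if_neg hj, Pi.sub_apply, Pi.single_eq_of_ne hj, sub_zero, add_zero]
    have key : ((l1N x : ℕ) : ℤ) = ((l1N (x - Pi.single i σ) : ℕ) : ℤ) + 1 := by
      unfold l1N
      push_cast
      rw [Finset.sum_congr rfl fun j _ => hdiff j, Finset.sum_add_distrib,
        Finset.sum_ite_eq' Finset.univ i (fun _ => (1 : ℤ)), if_pos (Finset.mem_univ _)]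
    omega

/-- **Telescoping along a lattice path:** if every unit-step difference of `g` is bounded by `G`,
then `|g(b) - g(a)| ≤ |b-a|₁ G`. [folklore] -/
theorem abs_sub_le_l1N_mul {g : Site d → ℝ} {G : ℝ}
    (hG : ∀ e, IsUnitStep e → ∀ y, |g (y + e) - g y| ≤ G) (a b : Site d) :
    |g b - g a| ≤ (l1N (b - a) : ℝ) * G := by
  suffices h : ∀ n : ℕ, ∀ b : Site d, l1N (b - a) = n → |g b - g a| ≤ (n : ℝ) * G from
    h _ b rfl
  intro n
  induction n with
  | zero =>
      intro b hb
      have : b = a := sub_eq_zero.mp (eq_zero_of_l1N_eq_zero hb)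
      subst this
      simp
  | succ n ih =>
      intro b hb
      obtain ⟨e, y, he, hbe, hy⟩ := exists_unitStep_of_l1N_pos (x := b - a) (by omega)
      have hy' : l1N (a + y - a) = n := by
        rw [add_sub_cancel_left]
        omega
      have hb' : b = (a + y) + e := by
        rw [add_assoc, ← hbe, add_sub_cancel]
      calc |g b - g a| = |(g (a + y + e) - g (a + y)) + (g (a + y) - g a)| := by rw [hb']; ring_nf
        _ ≤ |g (a + y + e) - g (a + y)| + |g (a + y) - g a| := abs_add_le _ _
        _ ≤ G + n * G := add_le_add (hG e he (a + y)) (ih (a + y) hy')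
        _ = ((n + 1 : ℕ) : ℝ) * G := by push_cast; ring

/-- **The symmetric second difference is second order:** if every double unit-step difference
`∇^e∇^{e'}f` is bounded by `G₂ ≥ 0`, then `|f(x) + f(-x) - 2f(0)| ≤ |x|₁² G₂` ("by discrete Taylor
approximation (and symmetry)"). Proof: peel one unit step `x = y + e`; the increment
`∇^ef(y) - ∇^ef(-y-e)` telescopes along a path of length `|2y+e|₁ ≤ 2|y|₁+1`, and
`Σ_{m<|x|₁}(2m+1) = |x|₁²`. [cite: Slade2017, §10.2 (displays (10.34)–(10.35): "discrete Taylor approximation (and symmetry)")] -/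
theorem abs_symmDiff_le {f : Site d → ℝ} {G₂ : ℝ} (hG₂ : 0 ≤ G₂)
    (h : ∀ e e', IsUnitStep e → IsUnitStep e' → ∀ y, |latGrad [e, e'] f y| ≤ G₂) (x : Site d) :
    |f x + f (-x) - 2 * f 0| ≤ (l1N x : ℝ) ^ 2 * G₂ := by
  suffices hh : ∀ n : ℕ, ∀ x : Site d, l1N x = n → |f x + f (-x) - 2 * f 0| ≤ (n : ℝ) ^ 2 * G₂ from
    hh _ x rfl
  intro n
  induction n with
  | zero =>
      intro x hx
      have : x = 0 := eq_zero_of_l1N_eq_zero hx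
      subst this
      have e0 : f 0 + f (-0) - 2 * f 0 = 0 := by rw [neg_zero]; ring
      rw [e0]
      simp
  | succ n ih =>
      intro x hx
      obtain ⟨e, y, he, hxe, hy⟩ := exists_unitStep_of_l1N_pos (x := x) (by omega)
      have hyn : l1N y = n := by omega
      -- the first difference `g = ∇^e f`
      set g : Site d → ℝ := fun z => f (z + e) - f z with hg
      have hgstep : ∀ e', IsUnitStep e' → ∀ z, |g (z + e') - g z| ≤ G₂ := by
        intro e' he' z
        have := h e' e he' he z
        simpa [latGrad, hg] using this
      have hpath := abs_sub_le_l1N_mul hgstep (-y - e) y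
      have hlen : (l1N (y - (-y - e)) : ℝ) ≤ 2 * n + 1 := by
        have e1 : y - (-y - e) = y + y + e := by abel
        rw [e1]
        have := (l1N_add_le (y + y) e).trans (add_le_add (l1N_add_le y y) le_rfl)
        rw [he.l1N_eq, hyn] at this
        exact_mod_cast (by omega : l1N (y + y + e) ≤ 2 * n + 1)
      have hincr : |g y - g (-y - e)| ≤ (2 * n + 1) * G₂ :=
        hpath.trans (mul_le_mul_of_nonneg_right hlen hG₂)
      have hdecomp : f x + f (-x) - 2 * f 0 = (f y + f (-y) - 2 * f 0) + (g y - g (-y - e)) := by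
        rw [hxe, hg]
        simp only [neg_add_rev]
        have e2 : -y - e + e = -y := by abel
        have e3 : -e + -y = -y - e := by abel
        rw [e3, e2]
        ring
      rw [hdecomp]
      calc |f y + f (-y) - 2 * f 0 + (g y - g (-y - e))|
          ≤ |f y + f (-y) - 2 * f 0| + |g y - g (-y - e)| := abs_add_le _ _
        _ ≤ (n : ℝ) ^ 2 * G₂ + (2 * n + 1) * G₂ := add_le_add (ih y hyn) hincr
        _ = ((n + 1 : ℕ) : ℝ) ^ 2 * G₂ := by push_cast; ring

/-- **Symmetrisation against an even weight:** for `ω` even,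
`Σ_{|x|₁<R} ω_x (f(x) - f(0)) = ½ Σ_{|x|₁<R} ω_x (f(x) + f(-x) - 2f(0))` — the linear Taylor term
drops out ("The identity (which follows from `w_{-x}² = w_x²`) `Σ_xΣ_i δ_k[w_x²]x_i(∇^{e_i}C)_0 = 0`").
[cite: Slade2017, §10.2 (display (10.34))] -/
theorem sum_even_mul_sub_eq {R : ℝ} {ω f : Site d → ℝ} (hω : ∀ x, ω (-x) = ω x) :
    ∑ x ∈ ball R, ω x * (f x - f 0) = 1 / 2 * ∑ x ∈ ball R, ω x * (f x + f (-x) - 2 * f 0) := by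
  have hre : ∑ x ∈ ball R, ω x * (f (-x) - f 0) = ∑ x ∈ ball R, ω x * (f x - f 0) := by
    refine Finset.sum_equiv (Equiv.neg (Site d)) (fun x => ?_) (fun x _ => ?_)
    · simp only [mem_ball, Equiv.neg_apply, Pi.neg_apply, Int.natAbs_neg]
    · simp only [Equiv.neg_apply, hω]
  have hsplit : ∑ x ∈ ball R, ω x * (f x + f (-x) - 2 * f 0) =
      ∑ x ∈ ball R, ω x * (f x - f 0) + ∑ x ∈ ball R, ω x * (f (-x) - f 0) := by
    rw [← Finset.sum_add_distrib]
    exact Finset.sum_congr rfl fun x _ => by ring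
  rw [hsplit, hre]
  ring

/-! ### The gradient bounds of Proposition 3.3.1 in terms of `M_j` (all `m² ≥ 0`) -/

/-- The bracket of (3.9) at `p' = 2α` is at most `6(1+m̄²)M_j` for `m² ∈ [0,m̄²]`, `j ≥ 1`.
[cite: Slade2017, §10.2 (proof of Lemma 5.2.1, opening: the second term is dominated by the first)] -/
theorem bracket_le_massFactor {α : ℝ} (hα0 : 0 < α) {L : ℝ} (hL : 2 ≤ L) {mbar m2 : ℝ} (hm2 : 0 ≤ m2)
    (hm2' : m2 ≤ mbar) {j : ℕ} (hj : 1 ≤ j) :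
    1 / (1 + m2 ^ 2 * (L ^ (j - 1)) ^ (2 * α)) + 1 / (1 + m2 * (L ^ (j - 1)) ^ (2 * α)) ≤
      6 * (1 + mbar) * massFactor L α m2 j := by
  have hL0 : (0 : ℝ) < L := by linarith
  have hmbar : 0 ≤ mbar := hm2.trans hm2'
  set ℓ : ℝ := L ^ (j - 1) with hℓ
  have hℓ1 : 1 ≤ ℓ := one_le_pow₀ (by linarith)
  have hℓ0 : 0 < ℓ := by linarith
  set A : ℝ := m2 * ℓ ^ α with hA
  have hA0 : 0 ≤ A := mul_nonneg hm2 (Real.rpow_nonneg hℓ0.le _)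
  have hM : massFactor L α m2 j = ((1 + A) ^ 2)⁻¹ := by rw [massFactor_eq hL0.le α m2 hj]
  have h2α : ℓ ^ (2 * α) = (ℓ ^ α) ^ 2 := by rw [mul_comm, Real.rpow_mul hℓ0.le, Real.rpow_two]
  have hfirst : 1 / (1 + m2 ^ 2 * ℓ ^ (2 * α)) ≤ 2 * ((1 + A) ^ 2)⁻¹ := by
    have : m2 ^ 2 * ℓ ^ (2 * α) = A ^ 2 := by rw [h2α, hA]; ring
    rw [this]
    exact one_div_one_add_sq_le hA0
  have hsecond : 1 / (1 + m2 * ℓ ^ (2 * α)) ≤ 2 * (1 + mbar) * (2 * ((1 + A) ^ 2)⁻¹) :=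
    (second_term_le hℓ1 hα0.le hm2 hm2').trans (mul_le_mul_of_nonneg_left hfirst (by positivity))
  have h0 : 0 ≤ ((1 + A) ^ 2)⁻¹ := by positivity
  rw [hM]
  nlinarith

/-- `m² ↦ M_j(m²)` is continuous at every `m² ≥ 0`. [cite: Slade2017, §5.2 (display defining `M_j`)] -/
theorem continuousAt_massFactor {L : ℝ} (hL : 0 < L) (α : ℝ) {m2 : ℝ} (hm2 : 0 ≤ m2) (j : ℕ) :
    ContinuousAt (fun m => massFactor L α m j) m2 := by
  unfold massFactor
  have hK : 0 ≤ L ^ (α * ((j : ℝ) - 1)) := Real.rpow_nonneg hL.le _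
  have hc : Continuous fun m : ℝ => (1 + m * L ^ (α * ((j : ℝ) - 1))) ^ 2 := by continuity
  refine hc.continuousAt.inv₀ ?_
  have : 0 < 1 + m2 * L ^ (α * ((j : ℝ) - 1)) := by nlinarith
  positivity

/-- **`|∇^l C_{j;0,x}(m²)| ≤ c (L^{j-1})^{α-d-|l|} M_j` for all `m² ∈ [0,m̄²]`** (unit-step lists `l`,
`L ≥ 2`, `j ≥ 1`; `c` depends on `d, |l|, α, m̄²`): Proposition 3.3.1 (3.9) with gradients in the
`M_j` form of §10.2 ("`|∇²C_{j+1}| ≲ M_jL^{-(d-α)j}L^{-2j}`", (10.35)). For `m² > 0` this is the printed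
form of (3.9); the value at `m² = 0` follows by continuity in `m²` of both sides.
[cite: Slade2017, Proposition 3.3.1 (display (3.9)); §10.2 (display (10.35))] -/
theorem abs_latGrad_fracCov_le_massFactor (hd : 1 ≤ d) (n : ℕ) {α : ℝ} (hα0 : 0 < α) (hα2 : α < 2)
    (hαd : α < d) {mbar : ℝ} (hmbar : 0 ≤ mbar) :
    ∃ c : ℝ, 0 < c ∧ ∀ l : List (Site d), l.length = n → (∀ e ∈ l, (∑ i, |((e i : ℤ) : ℝ)|) ≤ 1) →
      ∀ L : ℝ, 2 ≤ L → ∀ m2 : ℝ, 0 ≤ m2 → m2 ≤ mbar → ∀ j : ℕ, 1 ≤ j → ∀ x : Site d,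
        |latGrad l (fracCov d L α m2 j) x| ≤ c * (L ^ (j - 1)) ^ (α - d - n) * massFactor L α m2 j := by
  obtain ⟨c, hc, h⟩ := Slade2017_prop331_grad_estimate hd n hα0 hα2 hαd (p' := 2 * α) (by linarith)
  refine ⟨c * (6 * (1 + (mbar + 1))), by positivity, fun l hl hl1 L hL m2 hm2 hm2' j hj x => ?_⟩
  have hL0 : (0 : ℝ) < L := by linarith
  have hℓ0 : (0 : ℝ) < L ^ (j - 1) := by positivity
  set K : ℝ := c * (6 * (1 + (mbar + 1))) * (L ^ (j - 1)) ^ (α - d - n) with hK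
  -- positive masses
  have hpos : ∀ m : ℝ, 0 < m → m ≤ mbar + 1 →
      |latGrad l (fracCov d L α m j) x| ≤ K * massFactor L α m j := by
    intro m hm hm'
    calc |latGrad l (fracCov d L α m j) x|
        ≤ c * (L ^ (j - 1)) ^ (α - d - n) *
            (1 / (1 + m ^ 2 * (L ^ (j - 1)) ^ (2 * α)) + 1 / (1 + m * (L ^ (j - 1)) ^ (2 * α))) :=
          h l hl hl1 L hL m hm j hj x
      _ ≤ c * (L ^ (j - 1)) ^ (α - d - n) * (6 * (1 + (mbar + 1)) * massFactor L α m j) :=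
          mul_le_mul_of_nonneg_left (bracket_le_massFactor hα0 hL hm.le hm' hj)
            (mul_nonneg hc.le (Real.rpow_nonneg hℓ0.le _))
      _ = K * massFactor L α m j := by rw [hK]; ring
  rcases lt_or_eq_of_le hm2 with hm | hm
  · exact hpos m2 hm (by linarith)
  · -- `m² = 0`: pass to the limit `m ↓ 0`
    rw [← hm]
    have hF : Continuous fun m : ℝ => |latGrad l (fracCov d L α m j) x| :=
      (continuous_latGrad_fracCov_mass hd hα0 hα2 hL hj l x).abs
    have hG : ContinuousAt (fun m : ℝ => K * massFactor L α m j) 0 :=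
      continuousAt_const.mul (continuousAt_massFactor hL0 α le_rfl j)
    refine le_of_tendsto_of_tendsto (b := 𝓝[>] (0 : ℝ)) (hF.continuousAt.tendsto.mono_left nhdsWithin_le_nhds)
      (hG.tendsto.mono_left nhdsWithin_le_nhds) ?_
    filter_upwards [Ioc_mem_nhdsGT (zero_lt_one' ℝ)] with m hm'
    exact hpos m hm'.1 (by linarith [hm'.2])

/-! ### Powers of `L`: bookkeeping -/

/-- `(L^j)^a = (L^a)^j`. [folklore] -/
theorem pow_rpow_comm {L : ℝ} (hL : 0 ≤ L) (j : ℕ) (a : ℝ) : (L ^ j) ^ a = (L ^ a) ^ j := by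
  rw [← Real.rpow_natCast L j, ← Real.rpow_mul hL, mul_comm, Real.rpow_mul hL, Real.rpow_natCast]

/-- `(L^a)^j (L^b)^j = (L^{a+b})^j`. [folklore] -/
theorem rpow_pow_mul_rpow_pow {L : ℝ} (hL : 0 < L) (j : ℕ) (a b : ℝ) :
    (L ^ a) ^ j * (L ^ b) ^ j = (L ^ (a + b)) ^ j := by
  rw [← mul_pow, ← Real.rpow_add hL]

/-! ### The coefficients `γ̂`, `ξ'_j`, `ξ_j`, `ξ^W_j` -/

/-- **`γ̂ = (n+2)/(n+8)`** ((5.4)). [cite: Slade2017, §5.1 (display (5.4))] -/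
def gammaHat (n : ℕ) : ℝ := (n + 2) / (n + 8)

/-- `γ̂ ≥ 0`. [cite: Slade2017, §5.1 (display (5.4))] -/
theorem gammaHat_nonneg (n : ℕ) : 0 ≤ gammaHat n := by unfold gammaHat; positivity

/-- `γ̂ ≤ 1`. [cite: Slade2017, §5.1 (display (5.4))] -/
theorem gammaHat_le_one (n : ℕ) : gammaHat n ≤ 1 := by
  unfold gammaHat
  rw [div_le_one (by positivity)]
  linarith

/-- **`ξ'_j = 2(n+2)(δ[w^{(3)}] - 3w^{(2)}C) + γ̂β'_jη'_j`**, `C = C_{j+1;0,0}`, `δ[w^{(3)}] = w_{j+1}^{(3)} - w_j^{(3)}`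
((5.5); the coefficient of `β'_jη'_j` is `γ̂ = (n+2)/(n+8)`, cf. the same formula
"`ξ' = 2(2+n)(δ[w^{(3)}] - 3w^{(2)}C_{0,0}) + γβη'`" of [BBS-φ⁴-log], from which Proposition 5.1.1 is taken).
[cite: Slade2017, §5.1 (display (5.5)) and Proposition 5.1.1]
[cite: BauerschmidtBrydgesSlade2014Phi4Log, §3 (display defining `β, θ, ξ', π', σ, ζ`)] -/
def xiPrime (d n : ℕ) (L α m2 : ℝ) (j : ℕ) : ℝ :=
  2 * (n + 2) * (powSum (wCov d L α m2 (j + 1)) 3 - powSum (wCov d L α m2 j) 3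
      - 3 * powSum (wCov d L α m2 j) 2 * fracCov d L α m2 (j + 1) 0)
    + gammaHat n * betaPrime d n L α m2 j * etaPrime d n L α m2 j

/-- **`ξ_j = L^{(α-2ε)j}ξ'_j`** ((5.18); `α - 2ε = 2d - 3α`). [cite: Slade2017, §5.2 (display (5.18))] -/
def xiCoeff (d n : ℕ) (L α m2 : ℝ) (j : ℕ) : ℝ := (L ^ (2 * (d : ℝ) - 3 * α)) ^ j * xiPrime d n L α m2 j

/-- **`ξ^W_j = ξ_j - γ̂β_jη_{≥j} + L^{-(d-α)}η_{≥j+1}β_j`** (the display after `β^:_j` in §5.2; the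
abstract formula is `LongRangePhi4.xiW` of the change of variables of §5.3).
[cite: Slade2017, §5.2 (display after the definition of `β^:_j`)] -/
def xiWCoeff (d n : ℕ) (L α m2 : ℝ) (j : ℕ) : ℝ :=
  xiW ((L ^ ((d : ℝ) - α))⁻¹) (betaCoeff d n L α m2 j) (gammaHat n) (xiCoeff d n L α m2 j)
    (etaGe d n L α m2 j) (etaGe d n L α m2 (j + 1))

/-- **(10.30):** `δ[w^{(3)}] - 3w^{(2)}C_{j+1;0,0} = 3((w_j²C_{j+1})^{(1)} - w_j^{(2)}C_{j+1;0,0}) +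
3(w_jC_{j+1}²)^{(1)} + C_{j+1}^{(3)}`, as finite sums over the ball `|x|₁ < ½L^{j+1}` containing every
range involved. [cite: Slade2017, §10.2 (display (10.30))] -/
theorem delta_w3_decomposition (hd : 1 ≤ d) {L : ℝ} (hL : 1 ≤ L) (α m2 : ℝ) (j : ℕ) :
    powSum (wCov d L α m2 (j + 1)) 3 - powSum (wCov d L α m2 j) 3
        - 3 * powSum (wCov d L α m2 j) 2 * fracCov d L α m2 (j + 1) 0 =
      3 * ∑ x ∈ ball (L ^ (j + 1) / 2), wCov d L α m2 j x ^ 2 *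
          (fracCov d L α m2 (j + 1) x - fracCov d L α m2 (j + 1) 0) +
      3 * ∑ x ∈ ball (L ^ (j + 1) / 2), wCov d L α m2 j x * fracCov d L α m2 (j + 1) x ^ 2 +
      ∑ x ∈ ball (L ^ (j + 1) / 2), fracCov d L α m2 (j + 1) x ^ 3 := by
  set S := ball (d := d) (L ^ (j + 1) / 2) with hS
  have h3 : powSum (wCov d L α m2 (j + 1)) 3 = ∑ x ∈ S, wCov d L α m2 (j + 1) x ^ 3 :=
    powSum_eq_sum (fun x hx => wCov_eq_zero_of_not_mem_ball hd hL α m2 le_rfl hx) (by norm_num)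
  have h3' : powSum (wCov d L α m2 j) 3 = ∑ x ∈ S, wCov d L α m2 j x ^ 3 :=
    powSum_eq_sum (fun x hx => wCov_eq_zero_of_not_mem_ball hd hL α m2 (Nat.le_succ j) hx) (by norm_num)
  have h2 : powSum (wCov d L α m2 j) 2 = ∑ x ∈ S, wCov d L α m2 j x ^ 2 :=
    powSum_eq_sum (fun x hx => wCov_eq_zero_of_not_mem_ball hd hL α m2 (Nat.le_succ j) hx) (by norm_num)
  set w := wCov d L α m2 j with hw
  set C := fracCov d L α m2 (j + 1) with hC
  have hA : ∑ x ∈ S, wCov d L α m2 (j + 1) x ^ 3 = ∑ x ∈ S, w x ^ 3 + 3 * ∑ x ∈ S, w x ^ 2 * C x +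
      3 * ∑ x ∈ S, w x * C x ^ 2 + ∑ x ∈ S, C x ^ 3 := by
    have e : ∀ x ∈ S, wCov d L α m2 (j + 1) x ^ 3 =
        w x ^ 3 + 3 * (w x ^ 2 * C x) + 3 * (w x * C x ^ 2) + C x ^ 3 := by
      intro x _
      rw [wCov_succ]
      ring
    rw [Finset.sum_congr rfl e]
    simp only [Finset.sum_add_distrib, ← Finset.mul_sum]
  have hB : ∑ x ∈ S, w x ^ 2 * (C x - C 0) = ∑ x ∈ S, w x ^ 2 * C x - (∑ x ∈ S, w x ^ 2) * C 0 := by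
    rw [Finset.sum_mul, ← Finset.sum_sub_distrib]
    exact Finset.sum_congr rfl fun x _ => by ring
  rw [h3, h3', h2, hA, hB]
  ring

/-! ### Lemma 5.2.1: the bound on `ξ_j` -/

/-- **The weighted size of `w_j²`: `Σ_x w_{j;0,x}²|x|₁² ≤ c L^{d+α+2} (L^{2+ε})^j`** (any finite set of
sites; `L ≥ 2`, `m² ∈ [0,m̄²]`, `j ≥ 0`, `ε = 2α - d ≥ 0`): "we write `w_{j,x}² = Σ_{k=0}^{j-1}δ_k[w_x²]`
with `δ_k[w_x²] = w_{k+1,x}² - w_{k,x}²`", "(10.36) `Σ_xδ_k[w_x²]|x|² ≲ L^{2k}Σ_xδ_k[w_x²] ≲ L^{2k}β'_k ≲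
L^{2k}L^{εk}`", and `Σ_{k<j}L^{(2+ε)k} ≤ L^{(2+ε)j}` — the telescoping makes the geometric ratio `L^{2+ε}`.
[cite: Slade2017, §10.2 (displays (10.33), (10.36), (10.37))] -/
theorem sum_wCov_sq_mul_l1N_sq_le (hd : 1 ≤ d) {α : ℝ} (hα0 : 0 < α) (hα2 : α < 2) (hαd : α < d)
    (hdα : (d : ℝ) ≤ 2 * α) {mbar : ℝ} (hmbar : 0 ≤ mbar) :
    ∃ c : ℝ, 0 < c ∧ ∀ L : ℝ, 2 ≤ L → ∀ m2 : ℝ, 0 ≤ m2 → m2 ≤ mbar → ∀ j : ℕ,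
      ∀ S : Finset (Site d), ∑ x ∈ S, wCov d L α m2 j x ^ 2 * (l1N x : ℝ) ^ 2 ≤
        c * (L ^ d * L ^ α * L ^ 2) * (L ^ ((2 : ℝ) + (2 * α - d))) ^ j := by
  obtain ⟨c₂, hc₂, hD⟩ := sum_abs_wCov_sq_succ_sub_le hd hα0 hα2 hαd hmbar
  refine ⟨c₂, hc₂, fun L hL m2 hm2 hm2' j S => ?_⟩
  have hL0 : (0 : ℝ) < L := by linarith
  have hL1 : (1 : ℝ) ≤ L := by linarith
  set ρ : ℝ := L ^ ((2 : ℝ) + (2 * α - d)) with hρ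
  have hΛε : 1 ≤ L ^ (2 * α - (d : ℝ)) := Real.one_le_rpow hL1 (by linarith)
  have hρ2 : 2 ≤ ρ := by
    have : ρ = L ^ 2 * L ^ (2 * α - (d : ℝ)) := by
      rw [hρ, Real.rpow_add hL0, Real.rpow_two]
    rw [this]
    nlinarith
  -- telescoping `w_j² = Σ_{k<j} δ_k[w²]`
  set δ : ℕ → Site d → ℝ := fun k x => wCov d L α m2 (k + 1) x ^ 2 - wCov d L α m2 k x ^ 2 with hδ
  have htel : ∀ x, wCov d L α m2 j x ^ 2 = ∑ k ∈ Finset.range j, δ k x := by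
    intro x
    rw [Finset.sum_range_sub (fun k => wCov d L α m2 k x ^ 2), wCov_zero]
    ring
  -- pointwise: `δ_k` lives on `|x|₁ < ½L^{k+1}`
  have hpt : ∀ k x, |δ k x| * (l1N x : ℝ) ^ 2 ≤ (L ^ (k + 1) / 2) ^ 2 * |δ k x| := by
    intro k x
    by_cases hx : x ∈ ball (L ^ (k + 1) / 2)
    · rw [mem_ball] at hx
      rw [mul_comm]
      have h0 : (0 : ℝ) ≤ (l1N x : ℝ) := Nat.cast_nonneg _
      have : (l1N x : ℝ) ^ 2 ≤ (L ^ (k + 1) / 2) ^ 2 := pow_le_pow_left₀ h0 (le_of_lt hx) 2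
      exact mul_le_mul_of_nonneg_right this (abs_nonneg _)
    · have : δ k x = 0 := by
        simp only [hδ]
        rw [wCov_eq_zero_of_not_mem_ball hd hL1 α m2 le_rfl hx,
          wCov_eq_zero_of_not_mem_ball hd hL1 α m2 (Nat.le_succ k) hx]
        ring
      rw [this, abs_zero]
      simp
  -- the bound on each `k`
  have hk : ∀ k, k < j → ∑ x ∈ S, |δ k x| * (l1N x : ℝ) ^ 2 ≤ c₂ * (L ^ d * L ^ α * L ^ 2) / 4 * ρ ^ k := by
    intro k _
    have hDk := hD L hL m2 hm2 hm2' k S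
    have hMk : massFactor L α m2 k ≤ 1 := massFactor_le_one hL0 α hm2 k
    have hsk : (L ^ (2 * α - (d : ℝ))) ^ scaleMin L α m2 k ≤ (L ^ (2 * α - (d : ℝ))) ^ k :=
      pow_le_pow_right₀ hΛε (scaleMin_le L α m2 k)
    have hρk : (L ^ (k + 1) / 2) ^ 2 * (L ^ (2 * α - (d : ℝ))) ^ k = L ^ 2 / 4 * ρ ^ k := by
      rw [hρ, ← rpow_pow_mul_rpow_pow hL0 k 2 (2 * α - d), Real.rpow_two, ← pow_mul, pow_succ]
      ring
    calc ∑ x ∈ S, |δ k x| * (l1N x : ℝ) ^ 2 ≤ ∑ x ∈ S, (L ^ (k + 1) / 2) ^ 2 * |δ k x| :=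
          Finset.sum_le_sum fun x _ => hpt k x
      _ = (L ^ (k + 1) / 2) ^ 2 * ∑ x ∈ S, |δ k x| := by rw [Finset.mul_sum]
      _ ≤ (L ^ (k + 1) / 2) ^ 2 * (c₂ * L ^ d * L ^ α * massFactor L α m2 k *
            (L ^ (2 * α - d)) ^ scaleMin L α m2 k) := by gcongr
      _ ≤ (L ^ (k + 1) / 2) ^ 2 * (c₂ * L ^ d * L ^ α * 1 * (L ^ (2 * α - (d : ℝ))) ^ k) := by
          gcongr
      _ = c₂ * L ^ d * L ^ α * ((L ^ (k + 1) / 2) ^ 2 * (L ^ (2 * α - (d : ℝ))) ^ k) := by ring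
      _ = c₂ * (L ^ d * L ^ α * L ^ 2) / 4 * ρ ^ k := by rw [hρk]; ring
  -- the geometric sum `Σ_{k<j} ρ^k ≤ ρ^j`
  have hgeom : ∑ k ∈ Finset.range j, ρ ^ k ≤ ρ ^ j := by
    have hρ1 : 1 < ρ := by linarith
    rw [geom_sum_eq hρ1.ne' j, div_le_iff₀ (by linarith)]
    nlinarith [pow_pos (by linarith : (0 : ℝ) < ρ) j]
  calc ∑ x ∈ S, wCov d L α m2 j x ^ 2 * (l1N x : ℝ) ^ 2
      = ∑ x ∈ S, ∑ k ∈ Finset.range j, δ k x * (l1N x : ℝ) ^ 2 := by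
        refine Finset.sum_congr rfl fun x _ => ?_
        rw [htel x, Finset.sum_mul]
    _ = ∑ k ∈ Finset.range j, ∑ x ∈ S, δ k x * (l1N x : ℝ) ^ 2 := Finset.sum_comm
    _ ≤ ∑ k ∈ Finset.range j, ∑ x ∈ S, |δ k x| * (l1N x : ℝ) ^ 2 :=
        Finset.sum_le_sum fun k _ => Finset.sum_le_sum fun x _ =>
          mul_le_mul_of_nonneg_right (le_abs_self _) (by positivity)
    _ ≤ ∑ k ∈ Finset.range j, c₂ * (L ^ d * L ^ α * L ^ 2) / 4 * ρ ^ k :=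
        Finset.sum_le_sum fun k hk' => hk k (Finset.mem_range.mp hk')
    _ = c₂ * (L ^ d * L ^ α * L ^ 2) / 4 * ∑ k ∈ Finset.range j, ρ ^ k := by rw [Finset.mul_sum]
    _ ≤ c₂ * (L ^ d * L ^ α * L ^ 2) / 4 * ρ ^ j := by gcongr
    _ ≤ c₂ * (L ^ d * L ^ α * L ^ 2) * ρ ^ j := by
        have : 0 ≤ c₂ * (L ^ d * L ^ α * L ^ 2) * ρ ^ j := by positivity
        linarith

/-- **Lemma 5.2.1, `ξ_j = O(M_j)`** (for the explicit decomposition; constant depending on `L, m̄²,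
d, n, α`): `|ξ_j| ≤ c M_j` for all `m² ∈ [0,m̄²]` and all `j ≥ 0`, `L ≥ 2` fixed. The proof is the
printed one ("Bound on `ξ_j`", (10.29)–(10.37)): `ξ'_j = 2(n+2)·[3((w_j²C_{j+1})^{(1)} - w_j^{(2)}C_{j+1;0,0})
+ 3(w_jC_{j+1}²)^{(1)} + C_{j+1}^{(3)}] + γ̂β'_jη'_j`; `|C_{j+1}^{(3)}| ≤ ‖C_{j+1}‖_∞²‖C_{j+1}‖₁`,
`|(w_jC_{j+1}²)^{(1)}| ≤ ‖C_{j+1}‖_∞²‖w_j‖₁`, and for the Wick-ordered term the symmetry of `w_j²`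
removes the linear Taylor term, `|Σ_xw_x²(C_{0,x} - C_{0,0})| = ½|Σ_xw_x²(C_{0,x} + C_{0,-x} - 2C_{0,0})| ≤
½‖∇²C_{j+1}‖_∞Σ_xw_x²|x|₁²` with `Σ_xw_x²|x|₁² ≲ L^{(2+ε)j}` by the telescoping over `k`; each product
with the prefactor `L^{(α-2ε)j}` has total `L`-exponent zero, leaving `O(M_j + M_j² + M_j³) = O(M_j)`.
Scope: the printed `L`-independence of this particular constant is not reproduced (the constant
here carries explicit powers of `L`); the paper's restriction `d ≤ 3` is not needed, `2α ≥ d` is.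
[cite: Slade2017, Lemma 5.2.1 (bound on `ξ_j`); §10.2 (displays (10.29)–(10.37))] -/
theorem abs_xiCoeff_le (hd : 1 ≤ d) (n : ℕ) {α : ℝ} (hα0 : 0 < α) (hα2 : α < 2) (hαd : α < d)
    (hdα : (d : ℝ) ≤ 2 * α) {mbar : ℝ} (hmbar : 0 ≤ mbar) {L : ℝ} (hL : 2 ≤ L) :
    ∃ c : ℝ, 0 < c ∧ ∀ m2 : ℝ, 0 ≤ m2 → m2 ≤ mbar → ∀ j : ℕ,
      |xiCoeff d n L α m2 j| ≤ c * massFactor L α m2 j := by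
  obtain ⟨c₀, hc₀, hC⟩ := abs_fracCov_le_massFactor hd hα0 hα2 hαd hmbar
  obtain ⟨c₁, hc₁, hW⟩ := sum_abs_wCov_le hd hα0 hα2 hαd hmbar
  obtain ⟨c₃, hc₃, hC1⟩ := sum_abs_fracCov_le hd hα0 hα2 hαd hmbar
  obtain ⟨c₄, hc₄, hG⟩ := abs_latGrad_fracCov_le_massFactor hd 2 hα0 hα2 hαd hmbar
  obtain ⟨cQ, hcQ, hQ⟩ := sum_wCov_sq_mul_l1N_sq_le hd hα0 hα2 hαd hdα hmbar
  obtain ⟨cβ, hcβ, hβ⟩ := abs_betaCoeff_le hd n hα0 hα2 hαd hmbar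
  have hL0 : (0 : ℝ) < L := by linarith
  have hL1 : (1 : ℝ) ≤ L := by linarith
  -- the constants of the four terms
  obtain ⟨k1, hk1⟩ : ∃ k : ℝ, k = 1 / 2 * c₄ * (cQ * (L ^ d * L ^ α * L ^ 2)) := ⟨_, rfl⟩
  obtain ⟨k2, hk2⟩ : ∃ k : ℝ, k = c₀ ^ 2 * (c₁ * L ^ d) := ⟨_, rfl⟩
  obtain ⟨k3, hk3⟩ : ∃ k : ℝ, k = c₀ ^ 2 * (c₃ * L ^ d * L ^ α) := ⟨_, rfl⟩
  obtain ⟨k0, hk0⟩ : ∃ k : ℝ, k = cβ * L ^ d * L ^ α * ((n + 2) * c₀) := ⟨_, rfl⟩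
  have hk1p : 0 ≤ k1 := by rw [hk1]; positivity
  have hk2p : 0 ≤ k2 := by rw [hk2]; positivity
  have hk3p : 0 ≤ k3 := by rw [hk3]; positivity
  have hk0p : 0 ≤ k0 := by rw [hk0]; positivity
  refine ⟨2 * (n + 2) * (3 * k1 + 3 * k2 + k3) + k0 + 1, by positivity, fun m2 hm2 hm2' j => ?_⟩
  -- abbreviations
  set M : ℝ := massFactor L α m2 j with hM
  have hM0 : 0 ≤ M := (massFactor_pos hL0 α hm2 j).le
  have hM1 : M ≤ 1 := massFactor_le_one hL0 α hm2 j
  have hMs : massFactor L α m2 (j + 1) ≤ M := massFactor_succ_le hL1 hα0.le hm2 j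
  have hM2 : M ^ 2 ≤ M := by
    calc M ^ 2 = M * M := sq M
      _ ≤ 1 * M := mul_le_mul_of_nonneg_right hM1 hM0
      _ = M := one_mul M
  have hM3 : M ^ 3 ≤ M := by
    calc M ^ 3 = M ^ 2 * M := by ring
      _ ≤ M ^ 2 * 1 := mul_le_mul_of_nonneg_left hM1 (sq_nonneg M)
      _ = M ^ 2 := mul_one _
      _ ≤ M := hM2
  set S := ball (d := d) (L ^ (j + 1) / 2) with hS
  set C : Site d → ℝ := fracCov d L α m2 (j + 1) with hCdef
  set w : Site d → ℝ := wCov d L α m2 j with hwdef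
  have hP0 : 0 < (L ^ (2 * (d : ℝ) - 3 * α)) ^ j := by positivity
  -- unit identities for the powers of `L`
  have u1 : (L ^ (2 * (d : ℝ) - 3 * α)) ^ j *
      ((L ^ (α - (d : ℝ))) ^ j * (L ^ (α - (d : ℝ))) ^ j * (L ^ α) ^ j) = 1 := by
    rw [rpow_pow_mul_rpow_pow hL0, rpow_pow_mul_rpow_pow hL0, rpow_pow_mul_rpow_pow hL0]
    have : 2 * (d : ℝ) - 3 * α + (α - d + (α - d) + α) = 0 := by ring
    rw [this, Real.rpow_zero, one_pow]
  have u2 : (L ^ (2 * (d : ℝ) - 3 * α)) ^ j *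
      ((L ^ (α - (d : ℝ) - 2)) ^ j * (L ^ ((2 : ℝ) + (2 * α - d))) ^ j) = 1 := by
    rw [rpow_pow_mul_rpow_pow hL0, rpow_pow_mul_rpow_pow hL0]
    have : 2 * (d : ℝ) - 3 * α + (α - d - 2 + (2 + (2 * α - d))) = 0 := by ring
    rw [this, Real.rpow_zero, one_pow]
  have u3 : (L ^ (2 * (d : ℝ) - 3 * α)) ^ j * ((L ^ (2 * α - (d : ℝ))) ^ j * (L ^ (α - (d : ℝ))) ^ j) = 1 := by
    rw [rpow_pow_mul_rpow_pow hL0, rpow_pow_mul_rpow_pow hL0]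
    have : 2 * (d : ℝ) - 3 * α + (2 * α - d + (α - d)) = 0 := by ring
    rw [this, Real.rpow_zero, one_pow]
  -- the uniform bound on `C_{j+1}`
  have hA : ∀ x, |C x| ≤ c₀ * (L ^ (α - (d : ℝ))) ^ j * M := by
    intro x
    have h1 := hC L hL m2 hm2 hm2' (j + 1) (by omega) x
    rw [Nat.add_sub_cancel, pow_rpow_comm hL0.le] at h1
    exact h1.trans (mul_le_mul_of_nonneg_left hMs (by positivity))
  -- T3 = C^{(3)}
  have hT3 : |∑ x ∈ S, C x ^ 3| ≤
      k3 * ((L ^ (α - (d : ℝ))) ^ j * (L ^ (α - (d : ℝ))) ^ j * (L ^ α) ^ j) * M ^ 3 := by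
    have hl1 : ∑ x ∈ S, |C x| ≤ c₃ * L ^ d * (L ^ α * (L ^ α) ^ j) * M := by
      have := hC1 L hL m2 hm2 hm2' (j + 1) (by omega) S
      rw [pow_succ'] at this
      exact this.trans (mul_le_mul_of_nonneg_left hMs (by positivity))
    calc |∑ x ∈ S, C x ^ 3| ≤ ∑ x ∈ S, |C x ^ 3| := Finset.abs_sum_le_sum_abs _ _
      _ = ∑ x ∈ S, |C x| ^ 2 * |C x| := Finset.sum_congr rfl fun x _ => by rw [abs_pow]; ring
      _ ≤ ∑ x ∈ S, (c₀ * (L ^ (α - (d : ℝ))) ^ j * M) ^ 2 * |C x| :=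
          Finset.sum_le_sum fun x _ => mul_le_mul_of_nonneg_right
            (pow_le_pow_left₀ (abs_nonneg _) (hA x) 2) (abs_nonneg _)
      _ = (c₀ * (L ^ (α - (d : ℝ))) ^ j * M) ^ 2 * ∑ x ∈ S, |C x| := by rw [Finset.mul_sum]
      _ ≤ (c₀ * (L ^ (α - (d : ℝ))) ^ j * M) ^ 2 * (c₃ * L ^ d * (L ^ α * (L ^ α) ^ j) * M) :=
          mul_le_mul_of_nonneg_left hl1 (sq_nonneg _)
      _ = k3 * ((L ^ (α - (d : ℝ))) ^ j * (L ^ (α - (d : ℝ))) ^ j * (L ^ α) ^ j) * M ^ 3 := by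
          rw [hk3]; ring
  -- T2 = (w C²)^{(1)}
  have hT2 : |∑ x ∈ S, w x * C x ^ 2| ≤
      k2 * ((L ^ (α - (d : ℝ))) ^ j * (L ^ (α - (d : ℝ))) ^ j * (L ^ α) ^ j) * M ^ 2 := by
    have hl1 : ∑ x ∈ S, |w x| ≤ c₁ * L ^ d * (L ^ α) ^ j := by
      refine (hW L hL m2 hm2 hm2' j S).trans ?_
      have : (L ^ α) ^ scaleMin L α m2 j ≤ (L ^ α) ^ j :=
        pow_le_pow_right₀ (Real.one_le_rpow hL1 hα0.le) (scaleMin_le L α m2 j)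
      exact mul_le_mul_of_nonneg_left this (by positivity)
    calc |∑ x ∈ S, w x * C x ^ 2| ≤ ∑ x ∈ S, |w x * C x ^ 2| := Finset.abs_sum_le_sum_abs _ _
      _ = ∑ x ∈ S, |C x| ^ 2 * |w x| := Finset.sum_congr rfl fun x _ => by rw [abs_mul, abs_pow]; ring
      _ ≤ ∑ x ∈ S, (c₀ * (L ^ (α - (d : ℝ))) ^ j * M) ^ 2 * |w x| :=
          Finset.sum_le_sum fun x _ => mul_le_mul_of_nonneg_right
            (pow_le_pow_left₀ (abs_nonneg _) (hA x) 2) (abs_nonneg _)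
      _ = (c₀ * (L ^ (α - (d : ℝ))) ^ j * M) ^ 2 * ∑ x ∈ S, |w x| := by rw [Finset.mul_sum]
      _ ≤ (c₀ * (L ^ (α - (d : ℝ))) ^ j * M) ^ 2 * (c₁ * L ^ d * (L ^ α) ^ j) :=
          mul_le_mul_of_nonneg_left hl1 (sq_nonneg _)
      _ = k2 * ((L ^ (α - (d : ℝ))) ^ j * (L ^ (α - (d : ℝ))) ^ j * (L ^ α) ^ j) * M ^ 2 := by
          rw [hk2]; ring
  -- T1 = Σ w² (C - C(0)) : symmetrisation + second-order bound + telescoped weight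
  have hT1 : |∑ x ∈ S, w x ^ 2 * (C x - C 0)| ≤
      k1 * ((L ^ (α - (d : ℝ) - 2)) ^ j * (L ^ ((2 : ℝ) + (2 * α - d))) ^ j) * M := by
    -- `∇²C_{j+1}` bound
    have hG₂ : ∀ e e', IsUnitStep e → IsUnitStep e' → ∀ y,
        |latGrad [e, e'] C y| ≤ c₄ * (L ^ (α - (d : ℝ) - 2)) ^ j * M := by
      intro e e' he he' y
      have h1 := hG [e, e'] rfl (fun e'' he'' => by
        simp only [List.mem_cons, List.not_mem_nil, or_false] at he''
        rcases he'' with h | h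
        · rw [h]; exact he.sum_abs_le
        · rw [h]; exact he'.sum_abs_le) L hL m2 hm2 hm2' (j + 1) (by omega) y
      rw [Nat.add_sub_cancel, pow_rpow_comm hL0.le] at h1
      have e2 : α - (d : ℝ) - ((2 : ℕ) : ℝ) = α - d - 2 := by norm_num
      rw [e2] at h1
      exact h1.trans (mul_le_mul_of_nonneg_left hMs (by positivity))
    have hG₂0 : 0 ≤ c₄ * (L ^ (α - (d : ℝ) - 2)) ^ j * M := by positivity
    have heven : ∀ x, (fun y => w y ^ 2) (-x) = (fun y => w y ^ 2) x := by
      intro x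
      simp only [hwdef, wCov_neg]
    rw [hS, sum_even_mul_sub_eq (ω := fun y => w y ^ 2) (f := C) heven, abs_mul,
      abs_of_pos (by norm_num : (0 : ℝ) < 1 / 2)]
    calc 1 / 2 * |∑ x ∈ ball (L ^ (j + 1) / 2), w x ^ 2 * (C x + C (-x) - 2 * C 0)|
        ≤ 1 / 2 * ∑ x ∈ ball (L ^ (j + 1) / 2), |w x ^ 2 * (C x + C (-x) - 2 * C 0)| :=
          mul_le_mul_of_nonneg_left (Finset.abs_sum_le_sum_abs _ _) (by norm_num)
      _ ≤ 1 / 2 * ∑ x ∈ ball (L ^ (j + 1) / 2),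
            w x ^ 2 * ((l1N x : ℝ) ^ 2 * (c₄ * (L ^ (α - (d : ℝ) - 2)) ^ j * M)) := by
          refine mul_le_mul_of_nonneg_left (Finset.sum_le_sum fun x _ => ?_) (by norm_num)
          rw [abs_mul, abs_pow, sq_abs]
          exact mul_le_mul_of_nonneg_left (abs_symmDiff_le hG₂0 hG₂ x) (sq_nonneg _)
      _ = 1 / 2 * (c₄ * (L ^ (α - (d : ℝ) - 2)) ^ j * M) *
            ∑ x ∈ ball (L ^ (j + 1) / 2), w x ^ 2 * (l1N x : ℝ) ^ 2 := by
          rw [Finset.mul_sum, Finset.mul_sum]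
          exact Finset.sum_congr rfl fun x _ => by ring
      _ ≤ 1 / 2 * (c₄ * (L ^ (α - (d : ℝ) - 2)) ^ j * M) *
            (cQ * (L ^ d * L ^ α * L ^ 2) * (L ^ ((2 : ℝ) + (2 * α - d))) ^ j) :=
          mul_le_mul_of_nonneg_left (hQ L hL m2 hm2 hm2' j _) (by positivity)
      _ = k1 * ((L ^ (α - (d : ℝ) - 2)) ^ j * (L ^ ((2 : ℝ) + (2 * α - d))) ^ j) * M := by
          rw [hk1]; ring
  -- T0 = γ̂ β'_j η'_j
  have hT0 : |gammaHat n * betaPrime d n L α m2 j * etaPrime d n L α m2 j| ≤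
      k0 * ((L ^ (2 * α - (d : ℝ))) ^ j * (L ^ (α - (d : ℝ))) ^ j) * M ^ 2 := by
    have hb := (hβ L hL m2 hm2 hm2' j).1
    have hb' : |betaPrime d n L α m2 j| ≤ cβ * L ^ d * L ^ α * M * (L ^ (2 * α - (d : ℝ))) ^ j := by
      refine hb.trans ?_
      have : (L ^ (2 * α - (d : ℝ))) ^ scaleMin L α m2 j ≤ (L ^ (2 * α - (d : ℝ))) ^ j :=
        pow_le_pow_right₀ (Real.one_le_rpow hL1 (by linarith)) (scaleMin_le L α m2 j)
      exact mul_le_mul_of_nonneg_left this (by positivity)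
    have he : |etaPrime d n L α m2 j| ≤ (n + 2) * (c₀ * (L ^ (α - (d : ℝ))) ^ j * M) := by
      unfold etaPrime
      rw [abs_mul, abs_of_nonneg (by positivity : (0 : ℝ) ≤ (n : ℝ) + 2)]
      exact mul_le_mul_of_nonneg_left (hA 0) (by positivity)
    rw [abs_mul, abs_mul, abs_of_nonneg (gammaHat_nonneg n)]
    calc gammaHat n * |betaPrime d n L α m2 j| * |etaPrime d n L α m2 j|
        ≤ 1 * (cβ * L ^ d * L ^ α * M * (L ^ (2 * α - (d : ℝ))) ^ j) *
            ((n + 2) * (c₀ * (L ^ (α - (d : ℝ))) ^ j * M)) :=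
          mul_le_mul (mul_le_mul (gammaHat_le_one n) hb' (abs_nonneg _) zero_le_one) he
            (abs_nonneg _) (by positivity)
      _ = k0 * ((L ^ (2 * α - (d : ℝ))) ^ j * (L ^ (α - (d : ℝ))) ^ j) * M ^ 2 := by rw [hk0]; ring
  -- assembling
  have hξ' : xiPrime d n L α m2 j = 2 * (n + 2) * (3 * ∑ x ∈ S, w x ^ 2 * (C x - C 0) +
      3 * ∑ x ∈ S, w x * C x ^ 2 + ∑ x ∈ S, C x ^ 3) +
      gammaHat n * betaPrime d n L α m2 j * etaPrime d n L α m2 j := by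
    unfold xiPrime
    rw [delta_w3_decomposition hd hL1 α m2 j]
  have h2n : (0 : ℝ) ≤ 2 * (n + 2) := by positivity
  have key : |xiPrime d n L α m2 j| ≤
      2 * (n + 2) * (3 * (k1 * ((L ^ (α - (d : ℝ) - 2)) ^ j * (L ^ ((2 : ℝ) + (2 * α - d))) ^ j) * M) +
        3 * (k2 * ((L ^ (α - (d : ℝ))) ^ j * (L ^ (α - (d : ℝ))) ^ j * (L ^ α) ^ j) * M ^ 2) +
        k3 * ((L ^ (α - (d : ℝ))) ^ j * (L ^ (α - (d : ℝ))) ^ j * (L ^ α) ^ j) * M ^ 3) +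
      k0 * ((L ^ (2 * α - (d : ℝ))) ^ j * (L ^ (α - (d : ℝ))) ^ j) * M ^ 2 := by
    rw [hξ']
    refine (abs_add_le _ _).trans (add_le_add ?_ hT0)
    rw [abs_mul, abs_of_nonneg h2n]
    refine mul_le_mul_of_nonneg_left ?_ h2n
    refine (abs_add_le _ _).trans (add_le_add ((abs_add_le _ _).trans (add_le_add ?_ ?_)) hT3)
    · rw [abs_mul, abs_of_nonneg (by norm_num : (0 : ℝ) ≤ 3)]
      exact mul_le_mul_of_nonneg_left hT1 (by norm_num)
    · rw [abs_mul, abs_of_nonneg (by norm_num : (0 : ℝ) ≤ 3)]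
      exact mul_le_mul_of_nonneg_left hT2 (by norm_num)
  unfold xiCoeff
  rw [abs_mul, abs_of_pos hP0]
  calc (L ^ (2 * (d : ℝ) - 3 * α)) ^ j * |xiPrime d n L α m2 j|
      ≤ (L ^ (2 * (d : ℝ) - 3 * α)) ^ j *
          (2 * (n + 2) * (3 * (k1 * ((L ^ (α - (d : ℝ) - 2)) ^ j * (L ^ ((2 : ℝ) + (2 * α - d))) ^ j) * M) +
            3 * (k2 * ((L ^ (α - (d : ℝ))) ^ j * (L ^ (α - (d : ℝ))) ^ j * (L ^ α) ^ j) * M ^ 2) +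
            k3 * ((L ^ (α - (d : ℝ))) ^ j * (L ^ (α - (d : ℝ))) ^ j * (L ^ α) ^ j) * M ^ 3) +
          k0 * ((L ^ (2 * α - (d : ℝ))) ^ j * (L ^ (α - (d : ℝ))) ^ j) * M ^ 2) :=
        mul_le_mul_of_nonneg_left key hP0.le
    _ = 2 * (n + 2) * (3 * (k1 * ((L ^ (2 * (d : ℝ) - 3 * α)) ^ j *
            ((L ^ (α - (d : ℝ) - 2)) ^ j * (L ^ ((2 : ℝ) + (2 * α - d))) ^ j)) * M) +
          3 * (k2 * ((L ^ (2 * (d : ℝ) - 3 * α)) ^ j *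
            ((L ^ (α - (d : ℝ))) ^ j * (L ^ (α - (d : ℝ))) ^ j * (L ^ α) ^ j)) * M ^ 2) +
          k3 * ((L ^ (2 * (d : ℝ) - 3 * α)) ^ j *
            ((L ^ (α - (d : ℝ))) ^ j * (L ^ (α - (d : ℝ))) ^ j * (L ^ α) ^ j)) * M ^ 3) +
          k0 * ((L ^ (2 * (d : ℝ) - 3 * α)) ^ j *
            ((L ^ (2 * α - (d : ℝ))) ^ j * (L ^ (α - (d : ℝ))) ^ j)) * M ^ 2 := by ring
    _ = 2 * (n + 2) * (3 * (k1 * M) + 3 * (k2 * M ^ 2) + k3 * M ^ 3) + k0 * M ^ 2 := by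
        rw [u1, u2, u3]; ring
    _ ≤ 2 * (n + 2) * (3 * (k1 * M) + 3 * (k2 * M) + k3 * M) + k0 * M := by
        have e2 : k2 * M ^ 2 ≤ k2 * M := mul_le_mul_of_nonneg_left hM2 hk2p
        have e3 : k3 * M ^ 3 ≤ k3 * M := mul_le_mul_of_nonneg_left hM3 hk3p
        have e0 : k0 * M ^ 2 ≤ k0 * M := mul_le_mul_of_nonneg_left hM2 hk0p
        exact add_le_add (mul_le_mul_of_nonneg_left (add_le_add (add_le_add le_rfl
          (mul_le_mul_of_nonneg_left e2 (by norm_num))) e3) h2n) e0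
    _ ≤ (2 * (n + 2) * (3 * k1 + 3 * k2 + k3) + k0 + 1) * M := by
        have e : (2 * (n + 2) * (3 * k1 + 3 * k2 + k3) + k0 + 1) * M =
            2 * (n + 2) * (3 * (k1 * M) + 3 * (k2 * M) + k3 * M) + k0 * M + M := by ring
        rw [e]
        linarith [hM0]

/-- **Lemma 5.2.1, `ξ^W_j = O(M_j)`** ("Bound on `ξ^W`. This follows from the definition … together
with the estimates obtained above for `ξ_j, η_{≥j}, β_j`"); constant depending on `L, m̄², d, n, α`.
[cite: Slade2017, Lemma 5.2.1 (bound on `ξ^W_j`); §10.2 ("Bound on the decorated ξ")] -/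
theorem abs_xiWCoeff_le (hd : 1 ≤ d) (n : ℕ) {α : ℝ} (hα0 : 0 < α) (hα2 : α < 2) (hαd : α < d)
    (hdα : (d : ℝ) ≤ 2 * α) {mbar : ℝ} (hmbar : 0 ≤ mbar) {L : ℝ} (hL : 2 ≤ L) :
    ∃ c : ℝ, 0 < c ∧ ∀ m2 : ℝ, 0 ≤ m2 → m2 ≤ mbar → ∀ j : ℕ,
      |xiWCoeff d n L α m2 j| ≤ c * massFactor L α m2 j := by
  obtain ⟨cξ, hcξ, hξ⟩ := abs_xiCoeff_le hd n hα0 hα2 hαd hdα hmbar hL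
  obtain ⟨cβ, hcβ, hβ⟩ := abs_betaCoeff_le hd n hα0 hα2 hαd hmbar
  obtain ⟨cη, hcη, hη⟩ := summable_etaGe_and_abs_le hd n hα0 hα2 hαd hmbar
  have hL0 : (0 : ℝ) < L := by linarith
  have hL1 : (1 : ℝ) ≤ L := by linarith
  set r : ℝ := (L ^ ((d : ℝ) - α))⁻¹ with hr
  have hr0 : 0 ≤ r := by positivity
  have hr1 : r ≤ 1 := inv_le_one_of_one_le₀ (Real.one_le_rpow hL1 (by linarith))
  refine ⟨cξ + cβ * L ^ d * L ^ α * cη + cη * (cβ * L ^ d * L ^ α), by positivity,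
    fun m2 hm2 hm2' j => ?_⟩
  set M : ℝ := massFactor L α m2 j with hM
  have hM0 : 0 ≤ M := (massFactor_pos hL0 α hm2 j).le
  have hM1 : M ≤ 1 := massFactor_le_one hL0 α hm2 j
  have h1 := hξ m2 hm2 hm2' j
  have h2 := (hβ L hL m2 hm2 hm2' j).2
  have h3 := (hη L hL m2 hm2 hm2' j).2
  have h4 := (hη L hL m2 hm2 hm2' (j + 1)).2
  have h4' : |etaGe d n L α m2 (j + 1)| ≤ cη * M :=
    h4.trans (mul_le_mul_of_nonneg_left (massFactor_succ_le hL1 hα0.le hm2 j) hcη.le)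
  have e1 : gammaHat n * |betaCoeff d n L α m2 j| * |etaGe d n L α m2 j| ≤
      1 * (cβ * L ^ d * L ^ α * M) * (cη * M) :=
    mul_le_mul (mul_le_mul (gammaHat_le_one n) h2 (abs_nonneg _) zero_le_one) h3 (abs_nonneg _)
      (by positivity)
  have e2 : r * |etaGe d n L α m2 (j + 1)| * |betaCoeff d n L α m2 j| ≤
      1 * (cη * M) * (cβ * L ^ d * L ^ α * M) :=
    mul_le_mul (mul_le_mul hr1 h4' (abs_nonneg _) zero_le_one) h2 (abs_nonneg _) (by positivity)
  have hMM : M * M ≤ M := by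
    calc M * M ≤ 1 * M := mul_le_mul_of_nonneg_right hM1 hM0
      _ = M := one_mul M
  unfold xiWCoeff xiW
  calc |xiCoeff d n L α m2 j - gammaHat n * betaCoeff d n L α m2 j * etaGe d n L α m2 j +
          r * etaGe d n L α m2 (j + 1) * betaCoeff d n L α m2 j|
      ≤ |xiCoeff d n L α m2 j| + gammaHat n * |betaCoeff d n L α m2 j| * |etaGe d n L α m2 j| +
          r * |etaGe d n L α m2 (j + 1)| * |betaCoeff d n L α m2 j| := by
        refine (abs_add_le _ _).trans (add_le_add ((abs_sub _ _).trans (add_le_add le_rfl ?_)) ?_)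
        · rw [abs_mul, abs_mul, abs_of_nonneg (gammaHat_nonneg n)]
        · rw [abs_mul, abs_mul, abs_of_nonneg hr0]
    _ ≤ cξ * M + 1 * (cβ * L ^ d * L ^ α * M) * (cη * M) + 1 * (cη * M) * (cβ * L ^ d * L ^ α * M) :=
        add_le_add (add_le_add h1 e1) e2
    _ = cξ * M + (cβ * L ^ d * L ^ α * cη + cη * (cβ * L ^ d * L ^ α)) * (M * M) := by ring
    _ ≤ cξ * M + (cβ * L ^ d * L ^ α * cη + cη * (cβ * L ^ d * L ^ α)) * M :=
        add_le_add le_rfl (mul_le_mul_of_nonneg_left hMM (by positivity))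
    _ = (cξ + cβ * L ^ d * L ^ α * cη + cη * (cβ * L ^ d * L ^ α)) * M := by ring

/-- **Lemma 5.2.1, the bounds (5.22) on `ξ_j` and `ξ^W_j` packaged:** for fixed `L ≥ 2` and `m̄² ≥ 0`
there is `c` with `|ξ_j| ≤ cM_j` and `|ξ^W_j| ≤ cM_j` for all `m² ∈ [0,m̄²]`, `j ≥ 0` (for the explicit
decomposition; `d ≥ 1`, `d/2 ≤ α < 2 ∧ d`). Together with `Slade2017_lem521_core` this is (5.22)
except for the vacuum-energy coefficients `υ_{*,j}`.
[cite: Slade2017, Lemma 5.2.1 (display (5.22): the bounds on `ξ_j`, `ξ^W_j`)] -/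
theorem Slade2017_lem521_xi (hd : 1 ≤ d) (n : ℕ) {α : ℝ} (hα0 : 0 < α) (hα2 : α < 2) (hαd : α < d)
    (hdα : (d : ℝ) ≤ 2 * α) {mbar : ℝ} (hmbar : 0 ≤ mbar) {L : ℝ} (hL : 2 ≤ L) :
    ∃ c : ℝ, 0 < c ∧ ∀ m2 : ℝ, 0 ≤ m2 → m2 ≤ mbar → ∀ j : ℕ,
      |xiCoeff d n L α m2 j| ≤ c * massFactor L α m2 j ∧
      |xiWCoeff d n L α m2 j| ≤ c * massFactor L α m2 j := by
  obtain ⟨c₁, hc₁, h₁⟩ := abs_xiCoeff_le hd n hα0 hα2 hαd hdα hmbar hL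
  obtain ⟨c₂, hc₂, h₂⟩ := abs_xiWCoeff_le hd n hα0 hα2 hαd hdα hmbar hL
  have hL0 : (0 : ℝ) < L := by linarith
  refine ⟨c₁ + c₂, by positivity, fun m2 hm2 hm2' j => ?_⟩
  have hM0 := (massFactor_pos hL0 α hm2 j).le
  exact ⟨(h₁ m2 hm2 hm2' j).trans (mul_le_mul_of_nonneg_right (by linarith) hM0),
    (h₂ m2 hm2 hm2' j).trans (mul_le_mul_of_nonneg_right (by linarith) hM0)⟩

/-! ### Lemma 5.2.1: continuity of `ξ'_j`, `ξ_j`, `ξ^W_j` in `m²` -/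

/-- `m² ↦ ξ'_j(m²)` and `m² ↦ ξ_j(m²)` are continuous on `ℝ` (finite sums of continuous functions; the
rescaling `L^{(α-2ε)j}` of `ξ_j` does not involve the mass scale).
[cite: Slade2017, Lemma 5.2.1 (continuity in m²)] -/
theorem continuous_xiCoeff_mass (hd : 1 ≤ d) (n : ℕ) {α : ℝ} (hα0 : 0 < α) (hα2 : α < 2) {L : ℝ}
    (hL : 2 ≤ L) (j : ℕ) :
    (Continuous fun m2 : ℝ => xiPrime d n L α m2 j) ∧ Continuous fun m2 : ℝ => xiCoeff d n L α m2 j := by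
  have h3 := continuous_powSum_wCov_mass hd hα0 hα2 hL (j + 1) (p := 3) (by norm_num)
  have h3' := continuous_powSum_wCov_mass hd hα0 hα2 hL j (p := 3) (by norm_num)
  have h2 := continuous_powSum_wCov_mass hd hα0 hα2 hL j (p := 2) (by norm_num)
  have hC := continuous_fracCov_mass hd hα0 hα2 hL (j := j + 1) (by omega) (0 : Site d)
  obtain ⟨-, hβ⟩ := continuous_wOne_betaPrime_mass hd n hα0 hα2 hL j
  have hη : Continuous fun m2 : ℝ => etaPrime d n L α m2 j := continuous_const.mul hC
  have hξ' : Continuous fun m2 : ℝ => xiPrime d n L α m2 j := by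
    unfold xiPrime
    exact (continuous_const.mul ((h3.sub h3').sub ((continuous_const.mul h2).mul hC))).add
      ((continuous_const.mul hβ).mul hη)
  exact ⟨hξ', continuous_const.mul hξ'⟩

/-- **Lemma 5.2.1, continuity of `ξ^W_j` in `m²` below the mass scale:** `m² ↦ ξ^W_j(m²)` is
continuous on `[0, L^{-α(j-1)})` (where `β_j` is; `ξ_j` and `η_{≥j}` are continuous on `[0,m̄²]`).
[cite: Slade2017, Lemma 5.2.1 (continuity in m²); Lemma 7.2.1 (proof)] -/
theorem continuousOn_xiWCoeff_mass (hd : 1 ≤ d) (n : ℕ) {α : ℝ} (hα0 : 0 < α) (hα2 : α < 2)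
    (hαd : α < d) {L : ℝ} (hL : 2 ≤ L) (j : ℕ) :
    ContinuousOn (fun m2 : ℝ => xiWCoeff d n L α m2 j) (Ico 0 (L ^ (-(α * ((j : ℝ) - 1))))) := by
  have hL0 : (0 : ℝ) < L := by linarith
  set T : ℝ := L ^ (-(α * ((j : ℝ) - 1))) with hT
  have hT0 : 0 ≤ T := (Real.rpow_pos_of_pos hL0 _).le
  obtain ⟨hβ, -, -⟩ := continuousOn_rescaled_mass hd n hα0 hα2 hL j
  have hβ' := hβ.mono (Ico_subset_Iio_self : Ico 0 T ⊆ Iio T)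
  have hη0 := (continuousOn_etaGe_mass hd n hα0 hα2 hαd hT0 hL j).mono
    (Ico_subset_Icc_self : Ico 0 T ⊆ Icc 0 T)
  have hη1 := (continuousOn_etaGe_mass hd n hα0 hα2 hαd hT0 hL (j + 1)).mono
    (Ico_subset_Icc_self : Ico 0 T ⊆ Icc 0 T)
  have hξ := (continuous_xiCoeff_mass hd n hα0 hα2 hL j).2.continuousOn (s := Ico 0 T)
  unfold xiWCoeff xiW
  exact (hξ.sub ((continuousOn_const.mul hβ').mul hη0)).add ((continuousOn_const.mul hη1).mul hβ')

end PT

end LongRangePhi4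

end Literature.Barriers.CriticalPhenomena
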